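import Literature.MathematicalPhysics.QuantumFieldTheory.Balaban1983to89.Node00.Record13NumericsOfThm1CCMWZB

/-!
# K1 ∕ K0 lanes — IS THE β OF RECORD BLIND TO THE BACKGROUND RADIUS `εbg`?  NO: the letter enters (1.20)–(1.22) through the background minimiser
# `U_{k+1}(εbg; W)` of the merged term (1.6).  The exact residual obligations for a cross-radius transfer at the Z3 witness `θ₁₅ᶜᶜᴹᵂᶻᴮ(j; γ; εbg)`, typed.

Cell `ym-nodeO-ideate`, DEFINER seat `ym-nodeO-def-1` (gen 27), answering dag-n24-c g14's LOCATED-EPSBG (pub-ymgap bus, 2026-08-29T01:09Z: «is β of record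
εbg-blind? — the one-line `rfl` ∕ `simp` answer is DEF-1's»).  `--kind proof --supports stmt-QuantumFields-27364 --as helper`, COUNT-NEUTRAL.  NEW leaf; theorems only —
0 `def`, 0 `sorry`, 0 `instance`, 0 `notation`.  Imports DEF-1's Z3 `Node00/Record13NumericsOfThm1CCMWZB` only.
[I] = [Balaban1987RG1]; [B11] = [Balaban1985Variational]; [III] = [Balaban1988Convergent]; [IV] = [Balaban1989LargeFieldI].

THE ANSWER (read off the tree's definitions, no estimate).  `betaOfRecord₁₃ θ = betaOfRecord₈Tχ (TβOfRecord₁₃) (chiFixed29 θ.ν θ.ε₂₉) θ.toStage8Params` (`Node00/Record13`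
:180–181, unfolding :184–185) and `betaOfRecord₈Tχ T χ θ₈ = betaOfMerged (betaMerged F (mergedTermFamilyMatT F N T χ θ₈.εbg) θ₈.ρ8 θ₈.bV) (beta0OfMerged (…same family…) θ₈.v₀) θ₈.γ`
(:169–172): the β-functions of record READ `εbg` — exactly once, through the merged-term family (1.6)
`mergedTermT T χ ε K g k W = A_{k+1}(g; W) − A_k(g; Ū^k(U_{k+1}(ε; W)))` (`Node00/BackgroundActionT` :116–118), whose subtracted action is evaluated at THE BACKGROUND
MINIMISER `Uk F N K (k+1) ε W` OVER THE CLASS `bgReg … ε = 𝔘_{k+1}(ε)` (`Node00/BackgroundActionOfRecord` :99–101: `if h : UkExists … ε W then Classical.choose h else 1`).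
So the Z3 member `theta13OfThm1CCMWZB F N j γ εbg …` and the witnesses of record (`εbg = 1`: `theta13OfThm1CCMW(Z)`, DEF-1's bridge `theta13OfThm1CCMWZ_eq_B`) carry the
second moments of DIFFERENT merged-term families; NO `rfl` ∕ `simp` bridge `betaOfRecord₁₃ (θ…WZB εbg …) = betaOfRecord₁₃ (θ…W …)` exists (dag-n24-c's 200 k-heartbeat `rfl`
time-out was the elaborator unfolding `printedSeq` ∕ `Uk` in vain, not a near-miss), and none is a theorem of the tree: §1–§2 below type the EXACT residual obligations.  (Doc-only edition 2: the three tree locators of this paragraph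
corrected per referee ref-H READ-471 NIT-LOC; no declaration changed.)

CONTENTS.  §1 (generic, any transport `T`, χ, radii `ε, ε′`): `mergedTermT_eq_of_Uk_eq` (pointwise agreement of the minimisers ⇒ equal merged terms) ·
★ `mergedTermT_eq_of_orbitRel` (ORBIT agreement `OrbitRel (k+1) (U_{k+1}(ε;W)) (U_{k+1}(ε′;W))` + the residual-gauge invariance `HInvT … (k+1)` of `A_k ∘ Ū^k` ⇒ equal merged
terms) · the family forms `mergedTermFamilyMatT_eq_of_Uk_eq` ∕ `…_of_orbitRel` · `betaOfRecord₈Tχ_update_εbg` (updating `εbg` moves β ONLY through the family).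
§2 (at the Z3 witness): `toStage8Params_theta13OfThm1CCMWZB` (LOCATED, `rfl`: the Stage-8 view of the Z3 member IS the record's with the ONE field `εbg` updated) ·
`betaOfRecord₁₃_theta13OfThm1CCMWZB_eq` (`rfl`, the family displayed) · `…_tokens` (`rfl`: blind to `Efl`, `logz`) · `…_one` (`rfl`: the `εbg = 1` member's β IS the record's) ·
★★ `betaOfRecord₁₃_theta13OfThm1CCMWZB_eq_of_mergedTermFamily` ∕ `…_eq_of_Uk` ∕ ★★★ `…_eq_of_orbitRel`: β of the Z3 member at radius `εbg` = β of record GIVEN, respectively,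
equality of the two merged families ∕ pointwise agreement of the minimisers at radii `εbg` and `1` ∕ orbit agreement + `HInvT`; and the two-radii forms `…_eq_of_orbitRel₂`.

WHAT THIS SAYS FOR THE REPAIR MENU (dag-n24-c I.44599 (a)∕(b)∕(c)).  (a) «a ZB edition of the faces iff K0⁷'s box transfers to the ZB member» is NOT available by `rfl`, and the
transfer's honest price is ★★★'s hypothesis: the radius-`εbg` and radius-`1` minimisers lie in ONE residual orbit for every coarse datum — which [B11] Thm 1 does NOT supply for
the pair `(εbg ≤ a₀, 1)` (existence in `𝔘(B₃ε₁)`, uniqueness of the critical orbit in `𝔘(ε₀)` only for `ε₀ ≤ a₀`, and `1 ≤ a₀` is false under the guard `217·a₀ ≤ 2`; the radius-1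
minimiser, when it exists, is outside print's regime) — so (a) would rest on an un-printed identification; (b) (K0⁷'s stub 3 ∕ box RE-STATED at the print-regime member
`εbg := a₀`, k0 lane + registration) and (c) stand.  The `Uk`-level hypothesis of `…_eq_of_Uk` is stronger still (`Classical.choose` representatives need not agree even in one orbit).

HONEST FRAMING (binding).  Typing identities (`rfl` ∕ `funext` ∕ one `rw`) about the tree's OWN definitions; NO estimate; NO value of `εbg` chosen for anybody; nothing of Bałaban's
asserted; [B11] Thm 1, `HInvT`, `UkExists` stay NAMED, asserted nowhere; no K0⁷ (stmt-QuantumFields-20541, V21-G 0∕2) ∕ K1⁹ (27364, v10 0∕6, HARD FREEZE) ∕ K3⁸ (27366) text touched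
or used as proved; FLAG №7 (N09) NOT closed; counts unmoved (typed 28∕28 · discharged 7∕27 · A 7∕28 — the chair's words); R4 = the CONDITIONAL finite-𝕋⁴ rung `BalabanLadder.UV`
only — NOT continuum ∕ ℝ⁴ ∕ OS ∕ mass gap ∕ Clay.  Standard axioms only.
-/

noncomputable section

open scoped Matrix.Norms.L2Operator

namespace Summit.QuantumFields.YangMills.Theorems.K1ZBWitnessBetaRadius

open Literature.MathematicalPhysics.QuantumFieldTheory.Balaban1983to89
open Literature.MathematicalPhysics.QuantumFieldTheory.Balaban1983to89.Node00
open Literature.MathematicalPhysics.QuantumFieldTheory.Balaban1983to89.T4Continuum (T4Family)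
open Literature.MathematicalPhysics.QuantumFieldTheory.Balaban1983to89.T4FlagMemory (extd)
open Literature.MathematicalPhysics.QuantumFieldTheory.Balaban1983to89.B12GaugeOrbits021 (OrbitRel)

/-! ## §1  Generic: the radius enters β only through the merged term's background minimiser -/

section Generic

variable (F : T4Family) (N : ℕ) [NeZero N] (T : Transport F N) (χ : (K : ℕ) → (ℕ → ℝ) → (k : ℕ) → Density (F.P K) k (SU N))

/-- **Pointwise agreement of the background minimisers at two radii ⇒ the merged terms (1.6) agree** (one `rw`: the radius is read by `mergedTermT` only in
`Uk F N K (k+1) ε W`). [cite: Balaban1987RG1, (1.6) p.261, (0.21) p.256 (bookkeeping)] -/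
theorem mergedTermT_eq_of_Uk_eq {ε ε' : ℝ} {K : ℕ} (g : ℕ → ℝ) (k : ℕ) (W : GaugeField (F.P K) (k + 1) (SU N))
    (hU : Uk F N K (k + 1) ε W = Uk F N K (k + 1) ε' W) :
    mergedTermT F N T χ ε K g k W = mergedTermT F N T χ ε' K g k W := by
  unfold mergedTermT
  rw [hU]

/-- **★ ORBIT agreement of the two minimisers + residual-gauge invariance of `A_k ∘ Ū^k` (`HInvT … (k+1)`) ⇒ the merged terms agree** — the honest cross-radius
transfer shape ([I] (0.21): the variational functional «can be considered on orbits»). [cite: Balaban1987RG1, (0.21) p.256, (1.6) p.261; Balaban1985Variational, Thm 1 p.279 (bookkeeping)] -/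
theorem mergedTermT_eq_of_orbitRel {ε ε' : ℝ} {K : ℕ} (g : ℕ → ℝ) (k : ℕ) (W : GaugeField (F.P K) (k + 1) (SU N))
    (hO : OrbitRel (k + 1) (Uk F N K (k + 1) ε W) (Uk F N K (k + 1) ε' W)) (hI : HInvT F N T χ K g (k + 1)) :
    mergedTermT F N T χ ε K g k W = mergedTermT F N T χ ε' K g k W := by
  obtain ⟨u, hu, hEq⟩ := hO
  unfold mergedTermT
  rw [hEq, hI k (Nat.lt_succ_self k) u hu]

/-- Family form of `mergedTermT_eq_of_Uk_eq` (the matrix-carrier export the β-layer consumes). [cite: Balaban1987RG1, (1.20)–(1.22) p.264, (1.6) p.261 (bookkeeping)] -/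
theorem mergedTermFamilyMatT_eq_of_Uk_eq {ε ε' : ℝ}
    (hU : ∀ (K k : ℕ) (W : GaugeField (F.P K) (k + 1) (SU N)), Uk F N K (k + 1) ε W = Uk F N K (k + 1) ε' W) :
    mergedTermFamilyMatT F N T χ ε = mergedTermFamilyMatT F N T χ ε' := by
  funext k hist K W
  exact mergedTermT_eq_of_Uk_eq F N T χ (extd hist) k _ (hU K k _)

/-- ★ Family form of `mergedTermT_eq_of_orbitRel`. [cite: Balaban1987RG1, (0.21) p.256, (1.20)–(1.22) p.264 (bookkeeping)] -/
theorem mergedTermFamilyMatT_eq_of_orbitRel {ε ε' : ℝ}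
    (hO : ∀ (K k : ℕ) (W : GaugeField (F.P K) (k + 1) (SU N)), OrbitRel (k + 1) (Uk F N K (k + 1) ε W) (Uk F N K (k + 1) ε' W))
    (hI : ∀ (K : ℕ) (g : ℕ → ℝ) (k : ℕ), HInvT F N T χ K g (k + 1)) :
    mergedTermFamilyMatT F N T χ ε = mergedTermFamilyMatT F N T χ ε' := by
  funext k hist K W
  exact mergedTermT_eq_of_orbitRel F N T χ (extd hist) k _ (hO K k _) (hI K _ k)

/-- **Updating the Stage-8 letter `εbg` moves the χ-generic β ONLY through the merged-term family**: if the families at the new and the old radius agree, so do the β's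
(every other Stage-8 field — chart `ρ8`, basis `bV`, base histories `v₀`, window `γ` — is untouched by the update). [cite: Balaban1987RG1, (1.20)–(1.22) p.264, (0.21) p.256 (bookkeeping)] -/
theorem betaOfRecord₈Tχ_update_εbg (θ : Stage8Params F N) (e : ℝ) (h : mergedTermFamilyMatT F N T χ e = mergedTermFamilyMatT F N T χ θ.εbg) :
    betaOfRecord₈Tχ F N T χ { θ with εbg := e } = betaOfRecord₈Tχ F N T χ θ := by
  unfold betaOfRecord₈Tχ
  simp only [h]

end Generic

/-! ## §2  At DEF-1's Z3 witness `θ₁₅ᶜᶜᴹᵂᶻᴮ(j; γ; εbg)`: where the letter sits, what is `rfl`, and the exact obligations of a cross-radius transfer -/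

section Family

variable (F : T4Family) (N : ℕ) [NeZero N] (j : ℕ) (γ εbg εbg' ε₀ ε₂₉ B₃ B₃' a₀ a₁ : ℝ) (Efl logz Efl' logz' : B12.RunParams → ℕ → ℝ)

/-- **LOCATED (`rfl`): the Stage-8 view of the Z3 member IS the windowed z-witness's with EXACTLY ONE field updated, `εbg`.** [cite: Balaban1987RG1, (0.21) p.256; Balaban1989LargeFieldI, (0.3) p.176 (bookkeeping)] -/
theorem toStage8Params_theta13OfThm1CCMWZB :
    (theta13OfThm1CCMWZB F N j γ εbg ε₀ ε₂₉ B₃ B₃' a₀ a₁ Efl logz).toStage8Params =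
      { (theta13OfThm1CCMWZ F N j γ ε₀ ε₂₉ B₃ B₃' a₀ a₁ Efl logz).toStage8Params with εbg := εbg } := rfl

/-- **β OF THE Z3 MEMBER, DISPLAYED (`rfl`)**: the χ-generic β of record at the canonical transport and the (2.9) species of the collared numerics, read on the record's Stage-8
data WITH `εbg` UPDATED — the letter is visible in the term (it feeds `mergedTermFamilyMatT … εbg`). [cite: Balaban1987RG1, (1.20)–(1.22) p.264, (2.9) p.266, (0.21) p.256 (bookkeeping)] -/
theorem betaOfRecord₁₃_theta13OfThm1CCMWZB_eq :
    betaOfRecord₁₃ F N (theta13OfThm1CCMWZB F N j γ εbg ε₀ ε₂₉ B₃ B₃' a₀ a₁ Efl logz) =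
      betaOfRecord₈Tχ F N (TβOfRecord₁₃ F N) (chiFixed29 F N (numerics7OfThm1CCM F.L j ε₀ B₃ B₃' a₀ a₁) ε₂₉)
        { (theta13OfThm1CCMWZ F N j γ ε₀ ε₂₉ B₃ B₃' a₀ a₁ Efl logz).toStage8Params with εbg := εbg } := rfl

/-- **β of the Z3 member is blind to the normalisation letters `Efl`, `logz`** (`rfl`; as for Z2). [cite: Balaban1988Convergent, (1.15) p.249; Balaban1989LargeFieldII, (0.15) p.360 (bookkeeping)] -/
theorem betaOfRecord₁₃_theta13OfThm1CCMWZB_tokens :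
    betaOfRecord₁₃ F N (theta13OfThm1CCMWZB F N j γ εbg ε₀ ε₂₉ B₃ B₃' a₀ a₁ Efl logz) =
      betaOfRecord₁₃ F N (theta13OfThm1CCMWZB F N j γ εbg ε₀ ε₂₉ B₃ B₃' a₀ a₁ Efl' logz') := rfl

/-- **The `εbg = 1` member's β IS the β of the witness of record `θ₁₅ᶜᶜᴹᵂ(j; γ)`** (`rfl`; DEF-1's bridge `theta13OfThm1CCMWZ_eq_B` + k0-s3's `betaOfRecord₁₃_theta13OfThm1CCMWZ`). [cite: Balaban1987RG1, (1.20)–(1.22) p.264, (0.21) p.256 (bookkeeping)] -/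
theorem betaOfRecord₁₃_theta13OfThm1CCMWZB_one :
    betaOfRecord₁₃ F N (theta13OfThm1CCMWZB F N j γ 1 ε₀ ε₂₉ B₃ B₃' a₀ a₁ Efl logz) =
      betaOfRecord₁₃ F N (theta13OfThm1CCMW F N j γ ε₀ ε₂₉ B₃ B₃' a₀ a₁) := rfl

/-- **★★ TWO RADII, ONE OBLIGATION**: the β's of the Z3 members at radii `εbg`, `εbg′` agree as soon as the two merged-term families (1.6) agree. [cite: Balaban1987RG1, (1.6) p.261, (1.20)–(1.22) p.264 (bookkeeping)] -/
theorem betaOfRecord₁₃_theta13OfThm1CCMWZB_eq_of_mergedTermFamily₂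
    (h : mergedTermFamilyMatT F N (TβOfRecord₁₃ F N) (chiFixed29 F N (numerics7OfThm1CCM F.L j ε₀ B₃ B₃' a₀ a₁) ε₂₉) εbg =
      mergedTermFamilyMatT F N (TβOfRecord₁₃ F N) (chiFixed29 F N (numerics7OfThm1CCM F.L j ε₀ B₃ B₃' a₀ a₁) ε₂₉) εbg') :
    betaOfRecord₁₃ F N (theta13OfThm1CCMWZB F N j γ εbg ε₀ ε₂₉ B₃ B₃' a₀ a₁ Efl logz) =
      betaOfRecord₁₃ F N (theta13OfThm1CCMWZB F N j γ εbg' ε₀ ε₂₉ B₃ B₃' a₀ a₁ Efl logz) := by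
  rw [betaOfRecord₁₃_theta13OfThm1CCMWZB_eq, betaOfRecord₁₃_theta13OfThm1CCMWZB_eq,
    show ({ (theta13OfThm1CCMWZ F N j γ ε₀ ε₂₉ B₃ B₃' a₀ a₁ Efl logz).toStage8Params with εbg := εbg } : Stage8Params F N) =
      { ({ (theta13OfThm1CCMWZ F N j γ ε₀ ε₂₉ B₃ B₃' a₀ a₁ Efl logz).toStage8Params with εbg := εbg' } : Stage8Params F N) with εbg := εbg } from rfl]
  exact betaOfRecord₈Tχ_update_εbg F N _ _ _ εbg h

/-- **★★ β OF THE Z3 MEMBER = β OF RECORD, GIVEN equality of the merged-term families at radii `εbg` and `1`.** [cite: Balaban1987RG1, (1.6) p.261, (1.20)–(1.22) p.264 (bookkeeping)] -/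
theorem betaOfRecord₁₃_theta13OfThm1CCMWZB_eq_of_mergedTermFamily
    (h : mergedTermFamilyMatT F N (TβOfRecord₁₃ F N) (chiFixed29 F N (numerics7OfThm1CCM F.L j ε₀ B₃ B₃' a₀ a₁) ε₂₉) εbg =
      mergedTermFamilyMatT F N (TβOfRecord₁₃ F N) (chiFixed29 F N (numerics7OfThm1CCM F.L j ε₀ B₃ B₃' a₀ a₁) ε₂₉) 1) :
    betaOfRecord₁₃ F N (theta13OfThm1CCMWZB F N j γ εbg ε₀ ε₂₉ B₃ B₃' a₀ a₁ Efl logz) =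
      betaOfRecord₁₃ F N (theta13OfThm1CCMW F N j γ ε₀ ε₂₉ B₃ B₃' a₀ a₁) := by
  rw [betaOfRecord₁₃_theta13OfThm1CCMWZB_eq_of_mergedTermFamily₂ F N j γ εbg 1 ε₀ ε₂₉ B₃ B₃' a₀ a₁ Efl logz h]
  rfl

/-- **★★ …, GIVEN pointwise agreement of the background minimisers at radii `εbg` and `1`** (stronger than print ever gives: `Uk` is `Classical.choose` per radius). [cite: Balaban1987RG1, (0.21) p.256, (1.6) p.261 (bookkeeping)] -/
theorem betaOfRecord₁₃_theta13OfThm1CCMWZB_eq_of_Uk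
    (hU : ∀ (K k : ℕ) (W : GaugeField (F.P K) (k + 1) (SU N)), Uk F N K (k + 1) εbg W = Uk F N K (k + 1) 1 W) :
    betaOfRecord₁₃ F N (theta13OfThm1CCMWZB F N j γ εbg ε₀ ε₂₉ B₃ B₃' a₀ a₁ Efl logz) =
      betaOfRecord₁₃ F N (theta13OfThm1CCMW F N j γ ε₀ ε₂₉ B₃ B₃' a₀ a₁) :=
  betaOfRecord₁₃_theta13OfThm1CCMWZB_eq_of_mergedTermFamily F N j γ εbg ε₀ ε₂₉ B₃ B₃' a₀ a₁ Efl logz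
    (mergedTermFamilyMatT_eq_of_Uk_eq F N _ _ hU)

/-- **★★★ THE HONEST PRICE OF A CROSS-RADIUS TRANSFER**: β of the Z3 member at radius `εbg` = β of record GIVEN (i) for every torus, step and coarse datum the radius-`εbg` and
radius-`1` background minimisers lie in ONE residual orbit of level `k+1`, and (ii) the residual-gauge invariance `HInvT` of the actions `A_k ∘ Ū^k` at the canonical transport and
the (2.9) species.  (i) is NOT a sentence of [B11] Thm 1 for the pair `(εbg ≤ a₀, 1)` (radius `1` lies outside its regime `ε₀ ≤ a₀`). [cite: Balaban1985Variational, Thm 1 (8)–(9) p.279; Balaban1987RG1, (0.21) p.256, (1.1) p.260, (1.6) p.261, (1.20)–(1.22) p.264 (bookkeeping)] -/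
theorem betaOfRecord₁₃_theta13OfThm1CCMWZB_eq_of_orbitRel
    (hO : ∀ (K k : ℕ) (W : GaugeField (F.P K) (k + 1) (SU N)), OrbitRel (k + 1) (Uk F N K (k + 1) εbg W) (Uk F N K (k + 1) 1 W))
    (hI : ∀ (K : ℕ) (g : ℕ → ℝ) (k : ℕ), HInvT F N (TβOfRecord₁₃ F N) (chiFixed29 F N (numerics7OfThm1CCM F.L j ε₀ B₃ B₃' a₀ a₁) ε₂₉) K g (k + 1)) :
    betaOfRecord₁₃ F N (theta13OfThm1CCMWZB F N j γ εbg ε₀ ε₂₉ B₃ B₃' a₀ a₁ Efl logz) =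
      betaOfRecord₁₃ F N (theta13OfThm1CCMW F N j γ ε₀ ε₂₉ B₃ B₃' a₀ a₁) :=
  betaOfRecord₁₃_theta13OfThm1CCMWZB_eq_of_mergedTermFamily F N j γ εbg ε₀ ε₂₉ B₃ B₃' a₀ a₁ Efl logz
    (mergedTermFamilyMatT_eq_of_orbitRel F N _ _ hO hI)

/-- ★★★ Two-radii form (e.g. the print-regime member `εbg := a₀` against any other letter value). [cite: Balaban1985Variational, Thm 1 (8)–(9) p.279; Balaban1987RG1, (0.21) p.256, (1.6) p.261 (bookkeeping)] -/
theorem betaOfRecord₁₃_theta13OfThm1CCMWZB_eq_of_orbitRel₂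
    (hO : ∀ (K k : ℕ) (W : GaugeField (F.P K) (k + 1) (SU N)), OrbitRel (k + 1) (Uk F N K (k + 1) εbg W) (Uk F N K (k + 1) εbg' W))
    (hI : ∀ (K : ℕ) (g : ℕ → ℝ) (k : ℕ), HInvT F N (TβOfRecord₁₃ F N) (chiFixed29 F N (numerics7OfThm1CCM F.L j ε₀ B₃ B₃' a₀ a₁) ε₂₉) K g (k + 1)) :
    betaOfRecord₁₃ F N (theta13OfThm1CCMWZB F N j γ εbg ε₀ ε₂₉ B₃ B₃' a₀ a₁ Efl logz) =
      betaOfRecord₁₃ F N (theta13OfThm1CCMWZB F N j γ εbg' ε₀ ε₂₉ B₃ B₃' a₀ a₁ Efl logz) :=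
  betaOfRecord₁₃_theta13OfThm1CCMWZB_eq_of_mergedTermFamily₂ F N j γ εbg εbg' ε₀ ε₂₉ B₃ B₃' a₀ a₁ Efl logz
    (mergedTermFamilyMatT_eq_of_orbitRel F N _ _ hO hI)

/-- Hence also the GENERATED HISTORIES transfer under the same two inputs (`gOfRecord₁₃ = genSeq β g₀`). [cite: Balaban1987RG1, (0.17)–(0.20) pp.255–256 (bookkeeping)] -/
theorem gOfRecord₁₃_theta13OfThm1CCMWZB_eq_of_orbitRel
    (hO : ∀ (K k : ℕ) (W : GaugeField (F.P K) (k + 1) (SU N)), OrbitRel (k + 1) (Uk F N K (k + 1) εbg W) (Uk F N K (k + 1) 1 W))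
    (hI : ∀ (K : ℕ) (g : ℕ → ℝ) (k : ℕ), HInvT F N (TβOfRecord₁₃ F N) (chiFixed29 F N (numerics7OfThm1CCM F.L j ε₀ B₃ B₃' a₀ a₁) ε₂₉) K g (k + 1)) :
    gOfRecord₁₃ F N (theta13OfThm1CCMWZB F N j γ εbg ε₀ ε₂₉ B₃ B₃' a₀ a₁ Efl logz) =
      gOfRecord₁₃ F N (theta13OfThm1CCMW F N j γ ε₀ ε₂₉ B₃ B₃' a₀ a₁) := by
  funext p
  show FlowStepRuns.genSeq _ p.g0 = FlowStepRuns.genSeq _ p.g0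
  rw [betaOfRecord₁₃_theta13OfThm1CCMWZB_eq_of_orbitRel F N j γ εbg ε₀ ε₂₉ B₃ B₃' a₀ a₁ Efl logz hO hI]

end Family

end Summit.QuantumFields.YangMills.Theorems.K1ZBWitnessBetaRadius

end
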